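import Literature.MathematicalPhysics.QuantumFieldTheory.Balaban1983to89.B8Eq146AExpansion

/-!
# `Balaban1983to89.B8Eq140Level` — [Balaban1985RegularSpaces] (1.140) p. 100 AT ONE LEVEL ON ONE SET, and the
# geometry of «on Ω_j» (p. 77): the plaquettes through a bond, their sides, the sides of the plaquettes touching a set

statement-level skeleton of published theorems with citation tags; proofs where landed; nothing here is a claim about the Yang–Mills mass gap

T. Bałaban, *Spaces of regular gauge field configurations on a lattice and gauge fixing conditions*, Commun.
Math. Phys. **99** (1985) 75–102 `[Balaban1985RegularSpaces]` ("B8"; printed page = PDF page + 74).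
PDF held: `paper:balaban1985-cmp99-regular-spaces-gauge-fixing` (lit store), pp. 76–77, 84–86 and 100 read as text
(`p0002.txt`, `p0003.txt`, `p0010.txt`–`p0012.txt`, `p0026.txt`).  STATUS: published, refereed.
This file TYPES print's hypothesis (1.140) level by level on the `ℤ^d` carriers of the lineage (the abstract leaf is
the field `B8SectGH.GFData3.C140`) together with the finite geometry that the local estimates of Sect. C / Sect. G
read (companions `B8Eq148Local`, `B8Eq154Local`, `B8Prop7ClassAkLocal`: (1.44)–(1.54), (1.141)/(1.142) and the
`𝔄_k`-clause of Proposition 7 (1.144) for a general admissible family from LEVEL-WISE hypotheses).  Definitions with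
bodies and their API; nothing here is new mathematics and nothing here is a claim about the Clay problem.

WHAT IS REPRODUCED (lit-balaban SKELETON rows): **B8.Eq1.140** (concrete, level-wise: `Cond140`), **B8.Def§A**
(the p. 77 conventions, refined to «sides of the plaquettes touching Ω»: `SideTouches`).  Unit `lit-balaban-p40` (Phase-2
proof seat p40, gen 5), HOME `run/shared/lean/pub/lit-balaban/` (owner fold `lit-balaban-r05/ROWS-B8.md`).

## THE PRINTED TEXT (p. 76, p. 77, p. 100, quoted from the text layer)

«Let us denote by p_{μν}(x) a plaquette determined by the point x and vectors e_μ, e_ν, μ < ν, i.e.,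
p_{μν}(x) = ⟨x, x + ηe_μ, x + ηe_μ + ηe_ν, x + ηe_ν⟩ … (D^{η*}_U F)(x, x + ηe_μ) = (D^{η*}_U F)_μ(x)
= Σ_{ν<μ} (D^{η*}_{U,ν}F_{νμ})(x) − Σ_{ν>μ} (D^{η*}_{U,ν}F_{μν})(x). (1.2)» (p. 76)
«If Ω ⊂ T_η, then we denote by Ω also the set of bonds ⋃_{x∈Ω} st(x) = {bonds b ⊂ T_η: at least one end-point of
b belongs to Ω}. Similarly for the corresponding set of plaquettes.» (p. 77)
«We assume that we are given a gauge field configuration U₀, U₀ ∈ 𝔄_k({Ω_j}, α₀), (1.139) and a Lie algebra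
valued configuration A satisfying Lʲη|A|, (Lʲη)²|∇^η_{U₀}A|, (Lʲη)³|D^{η*}_{U₀}D^η_{U₀}A| < α₂ on Ω_j. (1.140)»
(p. 100)

## WHAT IS CERTIFIED HERE (kernel; axioms `propext` / `Classical.choice` / `Quot.sound`)

On the `ℤ^d` carriers of the lineage (`B7Prop1Explicit`: sites `Fin d → ℤ`, unit vectors `e μ`, bond fields
`Site d → Fin d → 𝔸ˣ`; `B8Ineq132`: `PlaqTouches`/`BondTouches` = the p. 77 conventions, `covDerivFwd` = `D^η_{U,μ}`
of (1.1); `B8Eq143PlaqExpansion.pdiv` = (1.2); `B8Eq146AExpansion.plaqCovDeriv` = `(D^η_{U₀}A)(p)`):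
* §0 `IsSide z κ ν y τ` («the bond `⟨y, y + e_τ⟩` is one of the four sides of `p_{κν}(z)`»); `PlaqNear μ x z κ ν`
  («the oriented plaquette `p_{κν}(z)`, `κ ≠ ν`, has `⟨x, x + e_μ⟩` as a side» — exactly the plaquettes `p_{νμ}(x)`,
  `p_{μν}(x)`, `p_{νμ}(x − e_ν)`, `p_{μν}(x − e_ν)` through which (1.2) reads a plaquette function at the bond:
  `plaqNear₁`–`plaqNear₄`); `BondNear μ x y τ` (a side of such a plaquette).
* §1 `SideTouches S y τ` («`⟨y, y + e_τ⟩` is a side of a plaquette touching `S`»): `plaqTouches_of_plaqNear` (a plaquette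
  through a bond touching `S` touches `S`), `sideTouches_of_bondNear`, `sideTouches_of_bondTouches` (`d ≥ 2`), `sideTouches_mono`.
* §2 **`Cond140 L η α₂ j S U₀ A`** = (1.140) AT LEVEL `j` ON `S`: `|A(b)| < α₂(Lʲη)⁻¹` and `|(D^η_{U₀,κ}A_τ)(y)| <
  α₂(Lʲη)⁻²` for the `SideTouches S` bonds `b = ⟨y, y + e_τ⟩` (all `κ`), `|(D^{η*}_{U₀}D^η_{U₀}A)(b)| < α₂(Lʲη)⁻³` for the
  bonds touching `S`; `cond140_anti` (anti-monotone in `S`).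

## HONEST SCOPE / LOCATED READING

(i) «ON Ω_j» FOR `|A|`, `|∇^η_{U₀}A|` IS READ ONE LAYER WIDER THAN THE p. 77 BOND CONVENTION: `SideTouches Ω_j` = the sides
of the plaquettes touching `Ω_j` ⊇ the bonds touching `Ω_j` (strictly: at a plaquette touching `Ω_j` in one corner `x`
only, the sides `⟨x + e_μ, x + e_μ + e_ν⟩`, `⟨x + e_ν, x + e_ν + e_μ⟩` have no end-point in `Ω_j`).  The local estimates
(1.46)–(1.54), (1.141) read `A` there, and print's constants `8α₂²`, `36d`, `50d` presuppose the bound `α₂(Lʲη)⁻¹` on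
those sides; under the literal convention they are only controlled at level `j − 1` on `Ω_{j−1}` (threshold
`Lα₂(Lʲη)⁻¹`), which would change the constants by `L`-dependent factors — recorded, not reproduced (GAPS.md).
(ii) `∇^η_{U₀}A` = all entries `(D^η_{U₀,κ}A_τ)(y)` including `κ = τ` (they enter (1.53) through (1.52)); an entry is
attached to its base bond `⟨y, y + e_τ⟩`.  (iii) `T_η` ↦ `ℤ^d`, `η > 0` explicit; plaquettes `p_{κν}(z)` for all
`κ ≠ ν` (both orientations), as in `B8Ineq132.CondAt`.  (iv) The third member is attached to the bonds touching `S`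
(literal convention; (1.142) reads it at the bond itself).
-/

noncomputable section

open scoped BigOperators
open NormedSpace Finset

namespace Literature.MathematicalPhysics.QuantumFieldTheory.Balaban1983to89.B8Eq140Level

open B7Prop1Explicit
open B8Ineq132 (plaqF covDerivFwd PlaqTouches BondTouches)
open B8Eq143PlaqExpansion (pdiv)
open B8Eq146AExpansion (plaqCovDeriv)

-- `Site` alone would resolve to the torus sites of `Setup.lean`; re-export the `ℤ^d` sites of `B7Prop1Explicit`.
export B7Prop1Explicit (Site)

variable {d : ℕ}

/-! ## §0 Geometry: the plaquettes through a bond and their sides -/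

section Geometry

/-- «`p_{μν}(x) = ⟨x, x + ηe_μ, x + ηe_μ + ηe_ν, x + ηe_ν⟩`» (p. 76): the bond `⟨y, y + e_τ⟩` is one of the four
sides `⟨z, z + e_κ⟩`, `⟨z + e_κ, z + e_κ + e_ν⟩`, `⟨z + e_ν, z + e_ν + e_κ⟩`, `⟨z, z + e_ν⟩` of the plaquette
`p_{κν}(z)`. [cite: Balaban1985RegularSpaces, (1.2) p.76 (definition of p_{μν}(x))] -/
def IsSide (z : Site d) (κ ν : Fin d) (y : Site d) (τ : Fin d) : Prop :=
  (y = z ∧ τ = κ) ∨ (y = z + e κ ∧ τ = ν) ∨ (y = z + e ν ∧ τ = κ) ∨ (y = z ∧ τ = ν)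

/-- The oriented plaquette `p_{κν}(z)`, `κ ≠ ν`, has the bond `⟨x, x + e_μ⟩` as a side — these are the plaquettes
`p_{νμ}(x)`, `p_{νμ}(x − e_ν)` (`ν < μ`) and `p_{μν}(x)`, `p_{μν}(x − e_ν)` (`ν > μ`) through which
`(D^{η*}_U F)(x, x + ηe_μ)` of (1.2) reads the plaquette function `F`.
[cite: Balaban1985RegularSpaces, (1.2) p.76, (1.45) p.84 («a value of this expression at a bond ⟨x, x + ηe_μ⟩»)] -/
def PlaqNear (μ : Fin d) (x : Site d) (z : Site d) (κ ν : Fin d) : Prop :=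
  κ ≠ ν ∧ IsSide z κ ν x μ

/-- The bond `⟨y, y + e_τ⟩` is a side of a plaquette through `⟨x, x + e_μ⟩` — the bonds on which the expansion
(1.45)–(1.54) at the bond `⟨x, x + e_μ⟩` evaluates `A` and `U₁ = e^{iηA}`.
[cite: Balaban1985RegularSpaces, (1.45)-(1.46) p.84] -/
def BondNear (μ : Fin d) (x : Site d) (y : Site d) (τ : Fin d) : Prop :=
  ∃ (z : Site d) (κ ν : Fin d), PlaqNear μ x z κ ν ∧ IsSide z κ ν y τ

variable {μ ν κ τ : Fin d} {x y z : Site d}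

/-- First side `⟨z, z + e_κ⟩`. [cite: Balaban1985RegularSpaces, (1.2) p.76] -/
theorem isSide₁ (z : Site d) (κ ν : Fin d) : IsSide z κ ν z κ := Or.inl ⟨rfl, rfl⟩

/-- Second side `⟨z + e_κ, z + e_κ + e_ν⟩`. [cite: Balaban1985RegularSpaces, (1.2) p.76] -/
theorem isSide₂ (z : Site d) (κ ν : Fin d) : IsSide z κ ν (z + e κ) ν := Or.inr (Or.inl ⟨rfl, rfl⟩)

/-- Third side `⟨z + e_ν, z + e_ν + e_κ⟩`. [cite: Balaban1985RegularSpaces, (1.2) p.76] -/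
theorem isSide₃ (z : Site d) (κ ν : Fin d) : IsSide z κ ν (z + e ν) κ := Or.inr (Or.inr (Or.inl ⟨rfl, rfl⟩))

/-- Fourth side `⟨z, z + e_ν⟩`. [cite: Balaban1985RegularSpaces, (1.2) p.76] -/
theorem isSide₄ (z : Site d) (κ ν : Fin d) : IsSide z κ ν z ν := Or.inr (Or.inr (Or.inr ⟨rfl, rfl⟩))

/-- `p_{νμ}(x) ∋ ⟨x, x + e_μ⟩` (its fourth side). [cite: Balaban1985RegularSpaces, (1.2) p.76] -/
theorem plaqNear₁ (hνμ : ν ≠ μ) : PlaqNear μ x x ν μ := ⟨hνμ, isSide₄ x ν μ⟩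

/-- `p_{μν}(x) ∋ ⟨x, x + e_μ⟩` (its first side). [cite: Balaban1985RegularSpaces, (1.2) p.76] -/
theorem plaqNear₂ (hνμ : ν ≠ μ) : PlaqNear μ x x μ ν := ⟨hνμ.symm, isSide₁ x μ ν⟩

/-- `p_{νμ}(x − e_ν) ∋ ⟨x, x + e_μ⟩` (its second side). [cite: Balaban1985RegularSpaces, (1.2) p.76] -/
theorem plaqNear₃ (hνμ : ν ≠ μ) : PlaqNear μ x (x - e ν) ν μ :=
  ⟨hνμ, Or.inr (Or.inl ⟨(sub_add_cancel x (e ν)).symm, rfl⟩)⟩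

/-- `p_{μν}(x − e_ν) ∋ ⟨x, x + e_μ⟩` (its third side). [cite: Balaban1985RegularSpaces, (1.2) p.76] -/
theorem plaqNear₄ (hνμ : ν ≠ μ) : PlaqNear μ x (x - e ν) μ ν :=
  ⟨hνμ.symm, Or.inr (Or.inr (Or.inl ⟨(sub_add_cancel x (e ν)).symm, rfl⟩))⟩

/-- A side of a plaquette through the bond is `BondNear`. [cite: Balaban1985RegularSpaces, (1.45) p.84] -/
theorem bondNear_of (hq : PlaqNear μ x z κ ν) (hs : IsSide z κ ν y τ) : BondNear μ x y τ := ⟨z, κ, ν, hq, hs⟩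

end Geometry

/-! ## §1 The sides of the plaquettes touching a set -/

section SideGeometry

/-- «Similarly for the corresponding set of plaquettes» (p. 77): the bond `⟨y, y + e_τ⟩` is a side of a plaquette
`p_{κν}(z)`, `κ ≠ ν`, with at least one corner in `S` — the bonds on which (1.141)/(1.142) «on S» read `A`.
[cite: Balaban1985RegularSpaces, p.77 (convention before (1.5))] -/
def SideTouches (S : Set (Site d)) (y : Site d) (τ : Fin d) : Prop :=
  ∃ (z : Site d) (κ ν : Fin d), κ ≠ ν ∧ PlaqTouches S z κ ν ∧ IsSide z κ ν y τ

variable {S T : Set (Site d)} {μ ν κ τ : Fin d} {x y z : Site d}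

/-- A plaquette through a bond touching `S` touches `S`. [cite: Balaban1985RegularSpaces, p.77 (convention before (1.5))] -/
theorem plaqTouches_of_plaqNear (hb : BondTouches S x μ) (hq : PlaqNear μ x z κ ν) : PlaqTouches S z κ ν := by
  rcases hq with ⟨-, h | h | h | h⟩ <;> obtain ⟨rfl, rfl⟩ := h <;> rcases hb with hb | hb
  · exact Or.inl hb
  · exact Or.inr (Or.inl hb)
  · exact Or.inr (Or.inl hb)
  · exact Or.inr (Or.inr (Or.inr hb))
  · exact Or.inr (Or.inr (Or.inl hb))
  · refine Or.inr (Or.inr (Or.inr ?_))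
    rwa [add_right_comm]
  · exact Or.inl hb
  · exact Or.inr (Or.inr (Or.inl hb))

/-- A side of a plaquette touching `S` is a `SideTouches` of `S`. [cite: Balaban1985RegularSpaces, p.77 (convention before (1.5))] -/
theorem sideTouches_of_plaqTouches (hκν : κ ≠ ν) (hp : PlaqTouches S z κ ν) (hs : IsSide z κ ν y τ) : SideTouches S y τ :=
  ⟨z, κ, ν, hκν, hp, hs⟩

/-- Every `BondNear` bond of a bond touching `S` is a `SideTouches` of `S`. [cite: Balaban1985RegularSpaces, p.77 (convention before (1.5))] -/
theorem sideTouches_of_bondNear (hb : BondTouches S x μ) (hn : BondNear μ x y τ) : SideTouches S y τ := by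
  obtain ⟨z, κ, ν, hq, hs⟩ := hn
  exact ⟨z, κ, ν, hq.1, plaqTouches_of_plaqNear hb hq, hs⟩

/-- A bond touching `S` is a `SideTouches` of `S` as soon as there is a second direction (`d ≥ 2`).
[cite: Balaban1985RegularSpaces, p.77 (convention before (1.5))] -/
theorem sideTouches_of_bondTouches (hκτ : κ ≠ τ) (hb : BondTouches S y τ) : SideTouches S y τ :=
  sideTouches_of_bondNear hb (bondNear_of (plaqNear₁ hκτ) (isSide₄ y κ τ))

/-- `SideTouches` is monotone in the set. [cite: Balaban1985RegularSpaces, p.77 (convention before (1.5))] -/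
theorem sideTouches_mono (hST : S ⊆ T) (h : SideTouches S y τ) : SideTouches T y τ := by
  obtain ⟨z, κ, ν, hκν, hp, hs⟩ := h
  refine ⟨z, κ, ν, hκν, ?_, hs⟩
  rcases hp with hp | hp | hp | hp
  exacts [Or.inl (hST hp), Or.inr (Or.inl (hST hp)), Or.inr (Or.inr (Or.inl (hST hp))),
    Or.inr (Or.inr (Or.inr (hST hp)))]

end SideGeometry

/-! ## §2 The hypothesis (1.140) at one level on one set -/

section Cond140

variable {𝔸 : Type*} [NormedRing 𝔸] [NormedAlgebra ℂ 𝔸]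

/-- **(1.140) AT LEVEL `j` ON THE SET `S`**: «Lʲη|A|, (Lʲη)²|∇^η_{U₀}A|, (Lʲη)³|D^{η*}_{U₀}D^η_{U₀}A| < α₂ on Ω_j» —
`|A(b)| < α₂(Lʲη)⁻¹` and `|(D^η_{U₀,κ}A_τ)(y)| < α₂(Lʲη)⁻²` for the sides `b = ⟨y, y + e_τ⟩` of the plaquettes
touching `S` (HONEST SCOPE (i): one layer wider than the p. 77 bond convention), `|(D^{η*}_{U₀}D^η_{U₀}A)(b)| <
α₂(Lʲη)⁻³` for the bonds touching `S`. [cite: Balaban1985RegularSpaces, (1.140) p.100] -/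
def Cond140 (L : ℕ) (η α₂ : ℝ) (j : ℕ) (S : Set (Site d)) (U₀ : Site d → Fin d → 𝔸ˣ)
    (A : Site d → Fin d → 𝔸) : Prop :=
  (∀ (y : Site d) (τ : Fin d), SideTouches S y τ → ‖A y τ‖ < α₂ * ((L : ℝ) ^ j * η)⁻¹) ∧
    (∀ (y : Site d) (κ τ : Fin d), SideTouches S y τ →
        ‖covDerivFwd η U₀ κ (fun z => A z τ) y‖ < α₂ * (((L : ℝ) ^ j * η)⁻¹) ^ 2) ∧
      ∀ (y : Site d) (μ : Fin d), BondTouches S y μ →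
        ‖pdiv η U₀ (plaqCovDeriv η U₀ A) μ y‖ < α₂ * (((L : ℝ) ^ j * η)⁻¹) ^ 3

/-- (1.140) on a set implies (1.140) on every subset. [cite: Balaban1985RegularSpaces, (1.140) p.100] -/
theorem cond140_anti {L : ℕ} {η α₂ : ℝ} {j : ℕ} {S T : Set (Site d)} (hST : S ⊆ T)
    {U₀ : Site d → Fin d → 𝔸ˣ} {A : Site d → Fin d → 𝔸} (h : Cond140 L η α₂ j T U₀ A) :
    Cond140 L η α₂ j S U₀ A :=
  ⟨fun y τ hy => h.1 y τ (sideTouches_mono hST hy), fun y κ τ hy => h.2.1 y κ τ (sideTouches_mono hST hy),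
    fun y μ hy => h.2.2 y μ (by rcases hy with hy | hy; exacts [Or.inl (hST hy), Or.inr (hST hy)])⟩

end Cond140

end Literature.MathematicalPhysics.QuantumFieldTheory.Balaban1983to89.B8Eq140Level

end
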